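import Mathlib.LinearAlgebra.Matrix.Permutation
import Literature.MathematicalPhysics.QuantumFieldTheory.QCDPhaseQuenchedTranslation
import Literature.MathematicalPhysics.QuantumLattice.GrassmannIntegralSubstitution
import Literature.MathematicalPhysics.QuantumLattice.GrassmannRelabelling
import HarnessLib

/-!
# Translation covariance of the honest lattice-QCD functional `qcdTorusExpect`

Topic `MathematicalPhysics/QuantumFieldTheory` (families `constructive-qft`, `yang-mills`); sequel of
`QCDPhaseQuenchedTranslation` (covariance of the `N_f`-flavour Wilson matrix, `diracMatrix_torusConfigShift`)
and `LatticeGaugeProofs` (translation invariance of the torus Wilson state, `wilsonMeasure_map_torusConfigShift`).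

The torus translation `y ↦ y + u` of the quark variables acts on the quark Grassmann algebra
`FermiAlg N_f S` of `QCDOS.lean` by the doubled relabelling `ψ̄_{f,y,c} ↦ ψ̄_{f,y+u,c}`,
`ψ_{f,y,c} ↦ ψ_{f,y+u,c}` (`quarkTranslate u`, an algebra automorphism; Montvay–Münster §4.1/§5.1:
the Wilson–Dirac action and the Berezin measure are translation invariant).  Proved here:

* `quarkTranslate_qbar/_q/_quadratic` — the action on generators and on bilinears
  (`ψ̄ A ψ ↦ ψ̄ (A ∘ (τ_{-u} × τ_{-u})) ψ`);
* `quarkTranslate_fermiBoltzmann` — `e^{−ψ̄ D[U] ψ} ↦ e^{−ψ̄ D[τ_u U] ψ}` (`τ_u U (x, μ) = U (x − u, μ)`,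
  tree `torusConfigShift`);
* `fermiIntegral_quarkTranslate` — the Berezin integral `∫dψ̄dψ` is invariant (the doubled permutation has
  sign `(sign)² = 1`, unit Jacobian in `GrassmannAlgebra.berezin_map`);
* `qcdTorusExpect_quarkTranslate` — **translation covariance of the honest signed functional**:
  `⟨u · X(τ_{−u} ·)⟩_{β,S,m} = ⟨X⟩_{β,S,m}` for every Grassmann-valued function `X` of the gauge field,
  every `β`, all bare masses, every torus;
* `QCDLatticeObservable.onTorus_add` — placing a gauge-invariant local observable at `x + v` is
  translating its placement at `x`: `A.onTorus S (x + v) U = quarkTranslate v̄ (A.onTorus S x (τ_{−v̄} U))`,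
  `v̄ = v mod S`;
* consequences: `qcdTorusExpect_onTorus_add` (one-point functions do not depend on the site),
  `qcdTorusExpect_onTorus_mul_onTorus_add`, `qcdTorusExpect_onTorus_mul_onTorus_mul_onTorus_add`
  (two- and three-point functions depend on the sites only through their differences).

This is the translation-covariance input (M5 of the audits of items AnomalyRigidity.UniformGapTreeDecay /
HeatSlicedQuarks.RobustYangMillsHandover) of every transfer-matrix / clustering argument for `qcdTorusExpect`.
References: Montvay–Münster 1994 §4.1 (4.21), §5.1 [MontvayMunster1994]; Osterwalder–Seiler 1978 §2
[OsterwalderSeiler1978]; Berezin 1966 Ch. I §3 [BerezinSecondQuant1966].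
-/

noncomputable section

open MeasureTheory
open Literature.MathematicalPhysics.QuantumLattice Literature.Probability.LatticeModels GrassmannAlgebra

namespace Literature.MathematicalPhysics.QuantumFieldTheory

variable {Nf S : ℕ} [NeZero S]

local notation "𝔾" => Matrix.specialUnitaryGroup (Fin 3) ℂ

/-! ### The doubled relabelling along the site translation -/

/-- The inverse of `quarkShift u` adds `u` to the site. [folklore] -/
@[simp] theorem quarkShift_symm_quarkEquiv (u : TorusSite 4 S) (f : Fin Nf) (y : TorusSite 4 S)
    (c : Fin 3 × Fin 4) :
    (quarkShift u).symm (quarkEquiv (f, (y, c))) = quarkEquiv (f, (y + u, c)) := by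
  rw [Equiv.symm_apply_eq, quarkShift_quarkEquiv, add_sub_cancel_right]

variable (Nf) in
/-- The doubled relabelling of the `ψ̄`/`ψ` labels along the site translation `y ↦ y + u`. [folklore] -/
def quarkTranslateEquiv (u : TorusSite 4 S) :
    (FermiIdx Nf S ⊕ₗ FermiIdx Nf S) ≃ (FermiIdx Nf S ⊕ₗ FermiIdx Nf S) :=
  toLex.symm.trans ((Equiv.sumCongr (quarkShift (Nf := Nf) u).symm (quarkShift (Nf := Nf) u).symm).trans
    toLex)

/-- The doubled relabelling on a `ψ̄`-label. [folklore] -/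
theorem quarkTranslateEquiv_inl (u : TorusSite 4 S) (i : FermiIdx Nf S) :
    quarkTranslateEquiv Nf u (toLex (Sum.inl i)) = toLex (Sum.inl ((quarkShift u).symm i)) := rfl

/-- The doubled relabelling on a `ψ`-label. [folklore] -/
theorem quarkTranslateEquiv_inr (u : TorusSite 4 S) (i : FermiIdx Nf S) :
    quarkTranslateEquiv Nf u (toLex (Sum.inr i)) = toLex (Sum.inr ((quarkShift u).symm i)) := rfl

variable (Nf) in
/-- **The torus translation of the quark Grassmann algebra** by `u`: the algebra automorphism of
`FermiAlg N_f S` induced on generators by `ψ̄_{f,y,c} ↦ ψ̄_{f,y+u,c}`, `ψ_{f,y,c} ↦ ψ_{f,y+u,c}`.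
[cite: MontvayMunster1994, §4.1 and §5.1] -/
def quarkTranslate (u : TorusSite 4 S) : FermiAlg Nf S →ₐ[ℂ] FermiAlg Nf S :=
  ExteriorAlgebra.map (LinearMap.funLeft ℂ ℂ (quarkTranslateEquiv Nf u).symm)

/-- `ψ̄ᵢ ↦ ψ̄_{τ i}` on enumerated generators. [folklore] -/
theorem quarkTranslate_psiBar (u : TorusSite 4 S) (i : FermiIdx Nf S) :
    quarkTranslate Nf u (psiBar ℂ i) = psiBar ℂ ((quarkShift u).symm i) := by
  rw [quarkTranslate, psiBar, map_funLeft_gen, quarkTranslateEquiv_inl, psiBar]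

/-- `ψᵢ ↦ ψ_{τ i}` on enumerated generators. [folklore] -/
theorem quarkTranslate_psi (u : TorusSite 4 S) (i : FermiIdx Nf S) :
    quarkTranslate Nf u (psi ℂ i) = psi ℂ ((quarkShift u).symm i) := by
  rw [quarkTranslate, psi, map_funLeft_gen, quarkTranslateEquiv_inr, psi]

/-- `ψ̄_{f,y,c} ↦ ψ̄_{f,y+u,c}`. [cite: MontvayMunster1994, §5.1] -/
@[simp] theorem quarkTranslate_qbar (u : TorusSite 4 S) (f : Fin Nf) (y : TorusSite 4 S) (c : Fin 3 × Fin 4) :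
    quarkTranslate Nf u (qbar (f, (y, c))) = qbar (f, (y + u, c)) := by
  rw [qbar, quarkTranslate_psiBar, quarkShift_symm_quarkEquiv, qbar]

/-- `ψ_{f,y,c} ↦ ψ_{f,y+u,c}`. [cite: MontvayMunster1994, §5.1] -/
@[simp] theorem quarkTranslate_q (u : TorusSite 4 S) (f : Fin Nf) (y : TorusSite 4 S) (c : Fin 3 × Fin 4) :
    quarkTranslate Nf u (q (f, (y, c))) = q (f, (y + u, c)) := by
  rw [q, quarkTranslate_psi, quarkShift_symm_quarkEquiv, q]

/-- **Bilinears transform by relabelling the matrix**: `ψ̄ A ψ ↦ ψ̄ (A ∘ (quarkShift u × quarkShift u)) ψ`.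
[cite: MontvayMunster1994, §4.1 (4.14)] -/
theorem quarkTranslate_quadratic (u : TorusSite 4 S) (A : Matrix (FermiIdx Nf S) (FermiIdx Nf S) ℂ) :
    quarkTranslate Nf u (quadratic ℂ A) = quadratic ℂ (A.submatrix (quarkShift u) (quarkShift u)) := by
  simp only [quadratic, map_sum, map_smul, map_mul, quarkTranslate_psiBar, quarkTranslate_psi]
  symm
  rw [← (quarkShift (Nf := Nf) u).symm.sum_comp]
  refine Finset.sum_congr rfl fun i _ => ?_
  rw [← (quarkShift (Nf := Nf) u).symm.sum_comp]
  refine Finset.sum_congr rfl fun j _ => ?_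
  rw [Matrix.submatrix_apply, Equiv.apply_symm_apply, Equiv.apply_symm_apply]

/-- **The fermionic Boltzmann factor is translated into the Boltzmann factor of the translated gauge
field**: `u · e^{−ψ̄ D[U] ψ} = e^{−ψ̄ D[τ_u U] ψ}`. [cite: MontvayMunster1994, §5.1] -/
theorem quarkTranslate_fermiBoltzmann (u : TorusSite 4 S) (U : GaugeConfig 4 S 𝔾) (mq : Fin Nf → ℝ) :
    quarkTranslate Nf u (fermiBoltzmann U mq) = fermiBoltzmann (torusConfigShift u U) mq := by
  have key : ∀ a : FermiAlg Nf S, quarkTranslate Nf u (grassmannExp a) = grassmannExp (quarkTranslate Nf u a) :=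
    fun a => map_funLeft_grassmannExp ℂ (quarkTranslateEquiv Nf u) a
  rw [fermiBoltzmann, fermiBoltzmann, key, quarkTranslate_quadratic, diracMatrix_torusConfigShift,
    Matrix.submatrix_neg]
  rfl

/-- The substitution `v ↦ v ∘ p` of the generator space along a permutation `p` of the labels has
determinant `sign p`. [folklore] -/
theorem det_funLeft_perm' {J : Type*} [Fintype J] [DecidableEq J] (p : Equiv.Perm J) :
    LinearMap.det (LinearMap.funLeft ℂ ℂ p) = ((Equiv.Perm.sign p : ℤˣ) : ℤ) := by
  rw [← LinearMap.det_toMatrix', ← Matrix.det_permutation]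
  congr 1
  ext i j
  rw [LinearMap.toMatrix'_apply, LinearMap.funLeft_apply, Equiv.Perm.permMatrix,
    PEquiv.toMatrix_toPEquiv_apply, Pi.single_apply, Pi.single_apply]
  exact if_congr eq_comm rfl rfl

/-- **The Berezin integral `∫dψ̄dψ` is translation invariant** (the doubled permutation has sign
`(sign τ)² = 1`). [cite: MontvayMunster1994, §4.1 (4.21)] [cite: BerezinSecondQuant1966, Ch. I §3] -/
theorem fermiIntegral_quarkTranslate (u : TorusSite 4 S) (x : FermiAlg Nf S) :
    fermiIntegral (quarkTranslate Nf u x) = fermiIntegral x := by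
  rw [fermiIntegral, quarkTranslate]
  refine berezin_map_of_det_eq_one ℂ ?_ x
  rw [det_funLeft_perm', Equiv.Perm.sign_symm,
    show quarkTranslateEquiv Nf u =
      Equiv.permCongr toLex (Equiv.sumCongr (quarkShift (Nf := Nf) u).symm (quarkShift (Nf := Nf) u).symm)
      from rfl,
    Equiv.Perm.sign_permCongr, Equiv.Perm.sign_sumCongr, Int.units_mul_self, Units.val_one, Int.cast_one]

/-! ### Translation covariance of the honest functional -/

omit [NeZero S] in
/-- Torus translations compose additively. [folklore] -/
theorem torusConfigShift_torusConfigShift (u w : TorusSite 4 S) (U : GaugeConfig 4 S 𝔾) :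
    torusConfigShift u (torusConfigShift w U) = torusConfigShift (u + w) U := by
  funext e
  simp only [torusConfigShift_apply, sub_sub]

omit [NeZero S] in
/-- The zero translation is the identity. [folklore] -/
@[simp] theorem torusConfigShift_zero' (U : GaugeConfig 4 S 𝔾) : torusConfigShift (0 : TorusSite 4 S) U = U := by
  funext e
  simp only [torusConfigShift_apply, sub_zero, Prod.mk.eta]

/-- **Torus Wilson integrals are translation invariant** (for any integrand; `τ_w` is a measurable
equivalence preserving `μ_W`). [folklore] -/
theorem integral_comp_torusConfigShift_wilson (β : ℝ) (w : TorusSite 4 S) (g : GaugeConfig 4 S 𝔾 → ℂ) :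
    ∫ U, g (torusConfigShift w U) ∂(wilsonMeasure (d := 4) (L := S) (fundamentalRep (Fin 3)) β) =
      ∫ U, g U ∂(wilsonMeasure (d := 4) (L := S) (fundamentalRep (Fin 3)) β) := by
  rw [← integral_map_equiv, wilsonMeasure_map_torusConfigShift]

/-- **Translation covariance of the honest lattice-QCD functional** (signed determinant, any `β`, all
bare masses, every torus): translating the quark variables of `X` by `u` while translating its gauge-field
argument back, `U ↦ u · X(τ_{−u} U)`, does not change `⟨·⟩_{β,S,m}` — the Wilson–Dirac action is covariant,
the Berezin measure and the Wilson state are invariant.  No measurability of `X` is needed (`τ` is a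
measurable equivalence preserving `μ_W`). [cite: MontvayMunster1994, §4.1 and §5.1] [cite: OsterwalderSeiler1978, §2] -/
theorem qcdTorusExpect_quarkTranslate (β : ℝ) (mq : Fin Nf → ℝ) (u : TorusSite 4 S)
    (X : GaugeConfig 4 S 𝔾 → FermiAlg Nf S) :
    qcdTorusExpect β S mq (fun U => quarkTranslate Nf u (X (torusConfigShift (-u) U))) =
      qcdTorusExpect β S mq X := by
  unfold qcdTorusExpect
  congr 1
  have hB : ∀ U : GaugeConfig 4 S 𝔾,
      fermiBoltzmann U mq = quarkTranslate Nf u (fermiBoltzmann (torusConfigShift (-u) U) mq) := by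
    intro U
    rw [quarkTranslate_fermiBoltzmann, torusConfigShift_torusConfigShift, add_neg_cancel,
      torusConfigShift_zero']
  calc ∫ U, fermiIntegral (quarkTranslate Nf u (X (torusConfigShift (-u) U)) * fermiBoltzmann U mq)
          ∂(wilsonMeasure (d := 4) (L := S) (fundamentalRep (Fin 3)) β)
      = ∫ U, (fun V => fermiIntegral (X V * fermiBoltzmann V mq)) (torusConfigShift (-u) U)
          ∂(wilsonMeasure (d := 4) (L := S) (fundamentalRep (Fin 3)) β) := by
        refine integral_congr_ae (Filter.Eventually.of_forall fun U => ?_)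
        simp only
        rw [hB U, ← map_mul, fermiIntegral_quarkTranslate]
    _ = ∫ U, fermiIntegral (X U * fermiBoltzmann U mq)
          ∂(wilsonMeasure (d := 4) (L := S) (fundamentalRep (Fin 3)) β) :=
        integral_comp_torusConfigShift_wilson β (-u) (fun V => fermiIntegral (X V * fermiBoltzmann V mq))

/-! ### Placing a local observable at a translated site -/

omit [NeZero S] in
/-- Translations of `ℤ⁴`-configurations compose additively. [folklore] -/
theorem configShift_add' {G : Type*} [MeasurableSpace G] (a b : _root_.Literature.Probability.LatticeModels.Site 4)
    (U : LGConfig 4 G) : configShift (a + b) U = configShift a (configShift b U) := by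
  funext e
  simp only [Literature.MathematicalPhysics.QuantumLattice.configShift_apply, sub_sub]

omit [NeZero S] in
/-- The periodic lift intertwines the two translations: `θ_w (Ũ) = (τ_{w mod S} U)~`. [folklore] -/
theorem configShift_torusLift {G : Type*} [MeasurableSpace G] (w : _root_.Literature.Probability.LatticeModels.Site 4)
    (U : GaugeConfig 4 S G) :
    configShift w (torusLift S U) = torusLift S (torusConfigShift (Torus.proj S w) U) :=
  congrFun (toTorusObservable_comp_configShift (G := G) S w id) U

omit [NeZero S] in
/-- `Torus.proj` is additive. [folklore] -/
theorem torusProj_add' (x y : _root_.Literature.Probability.LatticeModels.Site 4) :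
    Torus.proj S (x + y) = Torus.proj S x + Torus.proj S y := by
  funext i
  simp [Torus.proj]

omit [NeZero S] in
/-- `Torus.proj` commutes with negation. [folklore] -/
theorem torusProj_neg' (x : _root_.Literature.Probability.LatticeModels.Site 4) :
    Torus.proj S (-x) = -Torus.proj S x := by
  funext i
  simp [Torus.proj]

/-- The doubled relabelling carries the label of a boxed quark variable placed at `x` to its label placed
at `x + v`. [folklore] -/
theorem quarkTranslateEquiv_toTorusIdx {R : ℕ} (x v : _root_.Literature.Probability.LatticeModels.Site 4)
    (w : BoxFermiIdx Nf R ⊕ₗ BoxFermiIdx Nf R) :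
    quarkTranslateEquiv Nf (Torus.proj S v) (QCDLatticeObservable.toTorusIdx (Nf := Nf) (R := R) S x w) =
      QCDLatticeObservable.toTorusIdx (Nf := Nf) (R := R) S (x + v) w := by
  rcases w with i | i
  · change toLex (Sum.inl ((quarkShift (Torus.proj S v)).symm (quarkEquiv _))) = toLex (Sum.inl (quarkEquiv _))
    rw [quarkShift_symm_quarkEquiv, ← add_assoc, torusProj_add' (_ + x) v]
  · change toLex (Sum.inr ((quarkShift (Torus.proj S v)).symm (quarkEquiv _))) = toLex (Sum.inr (quarkEquiv _))
    rw [quarkShift_symm_quarkEquiv, ← add_assoc, torusProj_add' (_ + x) v]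

/-- **Placing a gauge-invariant local observable at `x + v` is translating its placement at `x`**:
`A.onTorus S (x + v) U = quarkTranslate v̄ (A.onTorus S x (τ_{−v̄} U))`, `v̄ = v mod S`.
[cite: OsterwalderSeiler1978, §2] -/
theorem QCDLatticeObservable.onTorus_add {R : ℕ} (A : QCDLatticeObservable Nf R)
    (x v : _root_.Literature.Probability.LatticeModels.Site 4) (U : GaugeConfig 4 S 𝔾) :
    A.onTorus S (x + v) U =
      quarkTranslate Nf (Torus.proj S v) (A.onTorus S x (torusConfigShift (-Torus.proj S v) U)) := by
  rw [QCDLatticeObservable.onTorus, QCDLatticeObservable.onTorus, quarkTranslate, ← AlgHom.comp_apply,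
    ExteriorAlgebra.map_comp_map]
  have hcfg : configShift (-(x + v)) (torusLift S U) =
      configShift (-x) (torusLift S (torusConfigShift (-Torus.proj S v) U)) := by
    rw [neg_add, configShift_add', configShift_torusLift, torusProj_neg']
  rw [hcfg]
  congr 2
  refine LinearMap.pi_ext fun w c => ?_
  simp only [LinearMap.comp_apply, Fintype.linearCombination_apply_single, map_smul, funLeft_symm_single,
    quarkTranslateEquiv_toTorusIdx]

/-! ### Consequences: `n`-point functions depend on the sites only through their differences -/

/-- **One-point functions of lattice QCD do not depend on the site.** [cite: OsterwalderSeiler1978, §2] -/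
theorem qcdTorusExpect_onTorus_add {R : ℕ} (β : ℝ) (mq : Fin Nf → ℝ) (A : QCDLatticeObservable Nf R)
    (x v : _root_.Literature.Probability.LatticeModels.Site 4) :
    qcdTorusExpect β S mq (fun U => A.onTorus S (x + v) U) = qcdTorusExpect β S mq (fun U => A.onTorus S x U) := by
  simp only [QCDLatticeObservable.onTorus_add A x v]
  exact qcdTorusExpect_quarkTranslate β mq (Torus.proj S v) (fun U => A.onTorus S x U)

/-- **Two-point functions of lattice QCD are translation invariant.** [cite: OsterwalderSeiler1978, §2] -/
theorem qcdTorusExpect_onTorus_mul_onTorus_add {R R' : ℕ} (β : ℝ) (mq : Fin Nf → ℝ)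
    (A : QCDLatticeObservable Nf R) (B : QCDLatticeObservable Nf R')
    (x y v : _root_.Literature.Probability.LatticeModels.Site 4) :
    qcdTorusExpect β S mq (fun U => A.onTorus S (x + v) U * B.onTorus S (y + v) U) =
      qcdTorusExpect β S mq (fun U => A.onTorus S x U * B.onTorus S y U) := by
  simp only [QCDLatticeObservable.onTorus_add _ _ v, ← map_mul]
  exact qcdTorusExpect_quarkTranslate β mq (Torus.proj S v) (fun U => A.onTorus S x U * B.onTorus S y U)

/-- **Three-point functions of lattice QCD are translation invariant.** [cite: OsterwalderSeiler1978, §2] -/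
theorem qcdTorusExpect_onTorus_mul_onTorus_mul_onTorus_add {R R' R'' : ℕ} (β : ℝ) (mq : Fin Nf → ℝ)
    (A : QCDLatticeObservable Nf R) (B : QCDLatticeObservable Nf R') (C : QCDLatticeObservable Nf R'')
    (x y z v : _root_.Literature.Probability.LatticeModels.Site 4) :
    qcdTorusExpect β S mq (fun U => A.onTorus S (x + v) U * B.onTorus S (y + v) U * C.onTorus S (z + v) U) =
      qcdTorusExpect β S mq (fun U => A.onTorus S x U * B.onTorus S y U * C.onTorus S z U) := by
  simp only [QCDLatticeObservable.onTorus_add _ _ v, ← map_mul]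
  exact qcdTorusExpect_quarkTranslate β mq (Torus.proj S v)
    (fun U => A.onTorus S x U * B.onTorus S y U * C.onTorus S z U)

/-- **The connected Euclidean-time correlator is based-point free**: `⟨A(w) B(w + n e₀)⟩ − ⟨A(w)⟩⟨B(w + n e₀)⟩`
equals the tree's `qcdLatticeConnectedCorr` (based at the origin). [cite: OsterwalderSeiler1978, §§2–4] -/
theorem qcdLatticeConnectedCorr_eq_based {R R' : ℕ} (β : ℝ) (T : ℕ) (mq : Fin Nf → ℝ)
    (A : QCDLatticeObservable Nf R) (B : QCDLatticeObservable Nf R') (n : ℕ)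
    (w : _root_.Literature.Probability.LatticeModels.Site 4) :
    qcdTorusExpect β (2 * T + 1) mq (fun U => A.onTorus (2 * T + 1) w U *
        B.onTorus (2 * T + 1) (Pi.single 0 (n : ℤ) + w) U) -
      qcdTorusExpect β (2 * T + 1) mq (A.onTorus (2 * T + 1) w) *
        qcdTorusExpect β (2 * T + 1) mq (B.onTorus (2 * T + 1) (Pi.single 0 (n : ℤ) + w)) =
      qcdLatticeConnectedCorr β (2 * T + 1) mq A B n := by
  rw [qcdLatticeConnectedCorr]
  have h1 := qcdTorusExpect_onTorus_mul_onTorus_add (S := 2 * T + 1) β mq A B 0 (Pi.single 0 (n : ℤ)) w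
  have h2 := qcdTorusExpect_onTorus_add (S := 2 * T + 1) β mq A 0 w
  have h3 := qcdTorusExpect_onTorus_add (S := 2 * T + 1) β mq B (Pi.single 0 (n : ℤ)) w
  simp only [zero_add] at h1 h2 h3
  rw [h1, show (A.onTorus (2 * T + 1) w) = fun U => A.onTorus (2 * T + 1) w U from rfl, h2,
    show (B.onTorus (2 * T + 1) (Pi.single 0 (n : ℤ) + w)) = fun U => B.onTorus (2 * T + 1) (Pi.single 0 (n : ℤ) + w) U
      from rfl, h3]

end Literature.MathematicalPhysics.QuantumFieldTheory

end
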